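import Summits.Parity.GeneralizedHardyLittlewood.Theorems.FordMaynardSieveConst01651SieveConst01651PiecesTab
import Summits.Parity.GeneralizedHardyLittlewood.Theorems.FordMaynardSieveConst01651SieveConst01651Cone01651
import HarnessLib

/-!
# Route `FordMaynardSieveConst01651`, target `SieveConst01651` (stmt-Parity-19185), stub `stub_coneCertClosed`,
# residue `hV`: the certificate value of the witness as twelve one-dimensional integrals

Def-free helper file.  The second residue of `stub_coneCertClosed` (see `…SignClauseFour.stub_coneCertClosed_of_residues'`,
`…FiveGeneric.stub_coneCertClosed_of_generic_five`) is `hV : 0 < sieveBoundG1 (1651/10000) coneCert`.  Since conjuncts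
(i) `isPiecewiseConstOnCone_coneCert`, (ii) `coneCert_empty` and (iii) `coneCert_support` are proved, hand -2 g0's kernel
normal form `…Cone01651.sieveBoundG1_coneData_01651` applies to the witness: `sieveBoundG1_coneCert_eq` writes
`V(ν₀, coneCert)` as `1 + ∑_{k=2}^{6} (1/k!)(F_k(1) + ∑_{r=1}^{min(k,4)−1} C(k,r) ∫₀¹ (r!·S⁰_r(t))·F_{k−r}(1−t) dt)` with the
witness's ordered slice functions `S⁰_r` (`r = 1, 2, 3`: from `g₁ ≡ −1`, the 1370-entry `g₂` table, the 2-entry `g₃` table;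
the face part is invisible to the integrals but that is NOT claimed here) and the universal kernels `F_m`.  `hV` is therefore
the positivity of an explicit finite combination of one-dimensional integrals — the statement a verified interval
evaluator (or an admitted Arb certificate: `0.002706498 ± 3.7·10⁻¹⁰`, kit j242906) has to establish.

References: [FordMaynard2024PrimeSieves] arXiv:2407.14368, Theorem 7.3 (a), §8.2.
-/

noncomputable section

open Finset MeasureTheory
open scoped Classical
open Literature.NumberTheory.Sieve Literature.NumberTheory.Sieve.FordMaynard

namespace Summit.Parity.GeneralizedHardyLittlewood.FordMaynardSieveConst01651SieveConst01651

/-- **The certificate value of the witness in kernel normal form.** [cite: FordMaynard2024PrimeSieves, Theorem 7.3 (a), §8.2] -/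
theorem sieveBoundG1_coneCert_eq :
    sieveBoundG1 (1651 / 10000) coneCert = 1 + ∑ k ∈ Icc 2 6, (1 / (k.factorial : ℝ)) *
      (sliceIntegral k 1 (fun u => if ∀ i, (1651 / 10000 : ℝ) < u i then 1 / ∏ i, u i else 0) +
        ∑ r ∈ Ico 1 (min k 4), (k.choose r : ℝ) * ∫ t in Set.Ioc 0 1,
          ((r.factorial : ℝ) * sliceIntegral r t
              (fun v => if (∀ i, (1651 / 10000 : ℝ) < v i) ∧ Monotone v then coneCert r v / ∏ i, v i else 0)) *
            sliceIntegral (k - r) (1 - t) (fun u => if ∀ i, (1651 / 10000 : ℝ) < u i then 1 / ∏ i, u i else 0)) :=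
  sieveBoundG1_coneData_01651 isPiecewiseConstOnCone_coneCert coneCert_empty coneCert_support

/-- **Residue `hV` restated**: the certificate value of the witness is positive iff the explicit twelve-integral expression
is positive. [cite: FordMaynard2024PrimeSieves, Theorem 7.3 (a), §8.2] -/
theorem coneCert_value_pos_iff :
    0 < sieveBoundG1 (1651 / 10000) coneCert ↔ 0 < 1 + ∑ k ∈ Icc 2 6, (1 / (k.factorial : ℝ)) *
      (sliceIntegral k 1 (fun u => if ∀ i, (1651 / 10000 : ℝ) < u i then 1 / ∏ i, u i else 0) +
        ∑ r ∈ Ico 1 (min k 4), (k.choose r : ℝ) * ∫ t in Set.Ioc 0 1,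
          ((r.factorial : ℝ) * sliceIntegral r t
              (fun v => if (∀ i, (1651 / 10000 : ℝ) < v i) ∧ Monotone v then coneCert r v / ∏ i, v i else 0)) *
            sliceIntegral (k - r) (1 - t) (fun u => if ∀ i, (1651 / 10000 : ℝ) < u i then 1 / ∏ i, u i else 0)) := by
  rw [sieveBoundG1_coneCert_eq]

end Summit.Parity.GeneralizedHardyLittlewood.FordMaynardSieveConst01651SieveConst01651

end
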